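import Literature.NumberTheory.DiophantineGeometry.PowerLineRadicalBelyiMap
import Literature.NumberTheory.DiophantineGeometry.BelyiMapFullConstantField
import Mathlib.NumberTheory.Cyclotomic.Basic
import HarnessLib

/-!
# Two radical layers over the power map: coverings of signature `(n, q, n)` for all `n ≥ 2`, `q ≥ 1`

Topic: `Literature/NumberTheory/DiophantineGeometry`. Theorem-only file (no definition, no named
fact) in the chain attached to the named fact `AbcWave0.darmonGranville1995_thm_2`. The one-layer
construction of `PowerLineRadicalBelyiMap` (`g^q = (t - 1)^a (t^n - 1)`, `f = t^n`) gives a covering of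
signature `(n, q, n)` only when `gcd(n - 1, q) = 1`, because over `ℚ` the closed point
`(t^n - 1)/(t - 1)` of the line must carry a single exponent. Over a field `K` containing a root of
unity `ζ ≠ 1`, `ζ^n = 1` (e.g. the cyclotomic field `ℚ(ζ_n)`), TWO radical layers remove the
condition (`AlgFunctionField.exists_belyiMap_signature_two_layer`):

* layer 1: `g₁^q = h₁ = (t - 1)(t - ζ)^{q - 1}` — totally ramified above `t = 1` and `t = ζ`
  (exponents `1`, `q - 1` prime to `q`), unramified everywhere else (`v_∞(h₁) = -q`);
* layer 2: `g₂^q = h₂ = (t - 1)^e (t^n - 1)`, `e ≡ -n (mod q)` (the function of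
  `PowerLineRadicalBelyiMap`) — above `t = 1` and `t = ζ` its order is a multiple of `q` after layer 1,
  so it is unramified there; above the other `n`-th roots of unity it is totally ramified; unramified
  above `t = 0, ∞` and the closed points `π₀(t^n)`, `π₀ ∉ {X, X - 1}`.

Hence every place above `t^n = 1` has total ramification index `q`, and `f = t^n` has zeros of order
`n`, poles of order `n`, `f - 1` has zeros of order `q`, and `F₂/K(f)` is unramified over the other
closed points; the constant field is then replaced by the full constant field of `F₂`
(`exists_fullConstantField_of_signature`, `BelyiMapFullConstantField`), a number field when `K` is.
(Monodromy: metabelian, a quotient of `(ℤ/q)² ⋊ ℤ/n`-type groups — still solvable; the point is that no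
condition on `(n, q)` survives.)

Consequences for Darmon–Granville's theorem modulo Faltings' theorem ONLY (no Riemann existence
theorem): for every hyperbolic signature with two equal entries — `(n, q, n)`, `(n, n, q)`, `(q, n, n)` —
the generalized Fermat equation has finitely many proper solutions
(`finite_properSolutions_signature_nqn_of_faltings`, `…_nnq_…`, `…_qnn_…`); e.g. `(2, ℓ, ℓ)`, `ℓ ≥ 5`,
`(3, 3, 4)`, `(3, 4, 4)`, `(2, 5, 5)`, `(2, 6, 6)`, `(p, p, ℓ)`.
[cite: DarmonGranville1995, Theorem 2 (p. 515) and Prop. 3.1 (p. 525)]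

## References

* H. Darmon, A. Granville, *On the equations `z^m = F(x, y)` and `A x^p + B y^q = C z^r`*, Bull. London
  Math. Soc. 27 (1995) 513–543: Theorem 2 (p. 515), Prop. 3.1 (p. 525). [DarmonGranville1995]
* H. Stichtenoth, *Algebraic Function Fields and Codes*, GTM 254, 2009: Prop. 3.7.3, Thm. 3.1.11.
  [Stichtenoth2009]
-/

noncomputable section

open scoped Classical Polynomial IntermediateField NumberField

namespace Literature.NumberTheory.DiophantineGeometry

open Polynomial IsDedekindDomain NumberField WithZero

universe u v

namespace AlgFunctionField

/-! ### A. One more transfer lemma: mixed fibres -/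

namespace PlaceOver

variable {K : Type u} {F : Type v} {F' : Type v} [Field K] [Field F] [Algebra K F]
variable [Field F'] [Algebra F F'] [Algebra K F'] [IsScalarTower K F F']
variable [IsAlgFunctionField K F] [IsAlgFunctionField K F'] [FiniteDimensional F F']
  [Algebra.IsSeparable F F']

/-- **Zeros, mixed layer.** If at every zero `P` of `s ∈ F` either `v_P(s) = p₀` and `q ∣ v_P(h)`, or
`q v_P(s) = p₀` and `v_P(h)` is prime to `q`, then every zero `Q` of `s` in `F' = F(h^{1/q})` has
`v_Q(s) = p₀`. [cite: Stichtenoth2009, Prop. 3.7.3(b)] -/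
theorem ord_algebraMap_eq_of_forall_ord_pos_mixed {q : ℕ} (hq : 0 < q) (hqK : (q : K) ≠ 0)
    {h : F} (hh0 : h ≠ 0) {g : F'} (hg : g ^ q = algebraMap F F' h) (hgen : F⟮g⟯ = ⊤)
    {s : F} {p₀ : ℤ}
    (hs : ∀ P : PlaceOver K F, 0 < P.ord s →
      (P.ord s = p₀ ∧ (q : ℤ) ∣ P.ord h) ∨ ((q : ℤ) * P.ord s = p₀ ∧ IsCoprime (P.ord h) (q : ℤ)))
    (Q : PlaceOver K F') (hQ : 0 < Q.ord (algebraMap F F' s)) : Q.ord (algebraMap F F' s) = p₀ := by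
  have hmul := Q.ord_algebraMap_eq_mul (K := K) (F := F) s
  have he1 := Q.one_le_ord_algebraMap_uniformizer (K := K) (F := F)
  have hPs : 0 < (Q.restrict (K := K) (F := F)).ord s := by
    by_contra hle
    have : Q.ord (algebraMap F F' ((Q.restrict (K := K) (F := F)).uniformizer : F)) *
        (Q.restrict (K := K) (F := F)).ord s ≤ 0 :=
      mul_nonpos_of_nonneg_of_nonpos (by omega) (not_lt.1 hle)
    omega
  rcases hs _ hPs with ⟨hp₀, hdvd⟩ | ⟨hp₀, hcop⟩
  · have he := (Q.restrict (K := K) (F := F)).ord_algebraMap_uniformizer_eq_one_of_pow_eq_of_dvd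
      hq hqK hh0 hdvd hg hgen Q rfl
    rw [hmul, he, one_mul, hp₀]
  · obtain ⟨he, -⟩ :=
      (Q.restrict (K := K) (F := F)).ord_algebraMap_uniformizer_eq_of_pow_eq_of_isCoprime
        hq hh0 hcop hg hgen Q rfl
    rw [hmul, he, hp₀]

end PlaceOver

/-! ### B. The first layer's function `h₁ = (t - 1)(t - ζ)^b` on the line -/

section LineH1

variable {K : Type u} [Field K] [CharZero K]

omit [CharZero K] in
/-- Polynomials in the transcendental `t` do not vanish. [folklore] -/
theorem aeval_ratFunc_X_ne_zero {p : K[X]} (hp : p ≠ 0) : aeval (RatFunc.X : RatFunc K) p ≠ 0 :=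
  fun h0 => RatFunc.transcendental_X (K := K) ⟨p, hp, h0⟩

omit [CharZero K] in
/-- If `t ∈ 𝒪_P` and `t^n - 1` is a unit at `P` (`n ≥ 1`), then `t - c` is a unit at `P` for every
`n`-th root of unity `c`. [folklore] -/
theorem ord_X_sub_C_eq_zero_of_pow_eq_one {n : ℕ} (hn : 0 < n) {c : K} (hc : c ^ n = 1)
    (P : PlaceOver K (RatFunc K)) (htO : (RatFunc.X : RatFunc K) ∈ P.toValuationSubring)
    (hunit : P.ord ((RatFunc.X : RatFunc K) ^ n - 1) = 0) :
    P.ord (aeval (RatFunc.X : RatFunc K) (X - C c : K[X])) = 0 := by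
  have hc0 : aeval (RatFunc.X : RatFunc K) (X - C c : K[X]) ≠ 0 :=
    aeval_ratFunc_X_ne_zero (X_sub_C_ne_zero c)
  have hnn := P.ord_nonneg_of_mem (P.aeval_mem htO (X - C c))
  by_contra hne
  have hpos : 0 < P.ord (aeval (RatFunc.X : RatFunc K) (X - C c : K[X])) := by omega
  have r := (P.ord_aeval_pos_iff htO hc0).1 hpos
  rw [map_sub, aeval_X, aeval_C, sub_eq_zero] at r
  have hp0 : aeval (RatFunc.X : RatFunc K) (X ^ n - 1 : K[X]) ≠ 0 := by
    refine aeval_ratFunc_X_ne_zero ?_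
    rw [← C_1]; exact X_pow_sub_C_ne_zero hn 1
  have hpos' : 0 < P.ord (aeval (RatFunc.X : RatFunc K) (X ^ n - 1 : K[X])) := by
    rw [P.ord_aeval_pos_iff htO hp0, map_sub, map_pow, aeval_X, map_one, r, ← map_pow, hc,
      map_one, sub_self]
  have : P.ord (aeval (RatFunc.X : RatFunc K) (X ^ n - 1 : K[X])) = 0 := by simpa using hunit
  omega

omit [CharZero K] in
/-- **`h₁` is a unit wherever `t^n - 1` is** (`t ∈ 𝒪_P`, `ζ^n = 1`, `n ≥ 1`): `v_P(h₁) = 0`.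
[folklore] -/
theorem twoLayer_ord_h₁_eq_zero {n : ℕ} (hn : 0 < n) (b : ℕ) {ζ : K} (hζn : ζ ^ n = 1)
    (P : PlaceOver K (RatFunc K)) (htO : (RatFunc.X : RatFunc K) ∈ P.toValuationSubring)
    (hunit : P.ord ((RatFunc.X : RatFunc K) ^ n - 1) = 0) :
    P.ord (aeval (RatFunc.X : RatFunc K) ((X - C 1) * (X - C ζ) ^ b)) = 0 := by
  have h10 : aeval (RatFunc.X : RatFunc K) (X - C 1 : K[X]) ≠ 0 :=
    aeval_ratFunc_X_ne_zero (X_sub_C_ne_zero 1)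
  have hζ0 : aeval (RatFunc.X : RatFunc K) (X - C ζ : K[X]) ≠ 0 :=
    aeval_ratFunc_X_ne_zero (X_sub_C_ne_zero ζ)
  rw [map_mul, map_pow, P.ord_mul_eq h10 (pow_ne_zero _ hζ0), P.ord_pow hζ0,
    ord_X_sub_C_eq_zero_of_pow_eq_one hn (one_pow n) P htO hunit,
    ord_X_sub_C_eq_zero_of_pow_eq_one hn hζn P htO hunit, mul_zero, add_zero]

omit [CharZero K] in
/-- **`h₁` at the zeros of `t`**: `v_P(h₁) = 0`. [folklore] -/
theorem twoLayer_ord_h₁_of_zero {n : ℕ} (hn : 0 < n) (b : ℕ) {ζ : K} (hζn : ζ ^ n = 1)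
    (P : PlaceOver K (RatFunc K)) (hP : 0 < P.ord (RatFunc.X : RatFunc K)) :
    P.ord (aeval (RatFunc.X : RatFunc K) ((X - C 1) * (X - C ζ) ^ b)) = 0 := by
  refine twoLayer_ord_h₁_eq_zero hn b hζn P (P.mem_of_ord_pos hP) ?_
  obtain ⟨-, hord⟩ := P.ord_aeval_eq_zero_of_eval_ne_zero hP (p := X ^ n - 1) (by simp [hn.ne'])
  simpa using hord

omit [CharZero K] in
/-- **`h₁` at the pole of `t`**: `v_P(h₁) = -(1 + b)`. [folklore] -/
theorem twoLayer_ord_h₁_of_pole (b : ℕ) (ζ : K) (P : PlaceOver K (RatFunc K))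
    (hP : P.ord (RatFunc.X : RatFunc K) < 0) :
    P.ord (aeval (RatFunc.X : RatFunc K) ((X - C 1) * (X - C ζ) ^ b)) = -(1 + b) := by
  have hut := RatFunc.transcendental_X (K := K)
  have hu1 := finrank_adjoin_ratFunc_X (K := K)
  have hPt1 : P.ord (RatFunc.X : RatFunc K) = -1 := P.ord_eq_neg_one_of_finrank_eq_one hut hu1 hP
  have hH0 : ((X - C 1) * (X - C ζ) ^ b : K[X]) ≠ 0 :=
    mul_ne_zero (X_sub_C_ne_zero 1) (pow_ne_zero _ (X_sub_C_ne_zero ζ))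
  obtain ⟨-, hord⟩ := P.ord_aeval_of_ord_neg hP (p := (X - C 1) * (X - C ζ) ^ b) hH0
  have hdeg : ((X - C 1) * (X - C ζ) ^ b : K[X]).natDegree = 1 + b := by
    rw [natDegree_mul (X_sub_C_ne_zero 1) (pow_ne_zero _ (X_sub_C_ne_zero ζ)), natDegree_pow,
      natDegree_X_sub_C, natDegree_X_sub_C, mul_one]
  rw [hord, hdeg, hPt1]
  push_cast
  ring

omit [CharZero K] in
/-- **The dichotomy for `h₁ = (t - 1)(t - ζ)^{q-1}`** (`ζ ≠ 1`): at every place `P` of the line,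
`v_P(h₁)` is either a multiple of `q` or prime to `q`. Indeed `v_P(h₁) = -q` at the pole of `t`, and
for `t ∈ 𝒪_P` one has `v_P(t - 1), v_P(t - ζ) ∈ {0, 1}`, not both `1`, so `v_P(h₁) ∈ {0, 1, q - 1}`.
[folklore] -/
theorem twoLayer_h₁_dichotomy {q : ℕ} (hq : 0 < q) {ζ : K} (hζ1 : ζ ≠ 1)
    (P : PlaceOver K (RatFunc K)) :
    (q : ℤ) ∣ P.ord (aeval (RatFunc.X : RatFunc K) ((X - C 1) * (X - C ζ) ^ (q - 1))) ∨
      IsCoprime (P.ord (aeval (RatFunc.X : RatFunc K) ((X - C 1) * (X - C ζ) ^ (q - 1)))) (q : ℤ) := by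
  have hut := RatFunc.transcendental_X (K := K)
  have hu1 := finrank_adjoin_ratFunc_X (K := K)
  have hu0 : (RatFunc.X : RatFunc K) ≠ 0 := RatFunc.X_ne_zero
  have h10 : aeval (RatFunc.X : RatFunc K) (X - C 1 : K[X]) ≠ 0 :=
    aeval_ratFunc_X_ne_zero (X_sub_C_ne_zero 1)
  have hζ0 : aeval (RatFunc.X : RatFunc K) (X - C ζ : K[X]) ≠ 0 :=
    aeval_ratFunc_X_ne_zero (X_sub_C_ne_zero ζ)
  by_cases htO : (RatFunc.X : RatFunc K) ∈ P.toValuationSubring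
  · -- `v(t - 1), v(t - ζ) ∈ {0, 1}`, not both `1`
    have hv : ∀ c : K, P.ord (aeval (RatFunc.X : RatFunc K) (X - C c : K[X])) = 0 ∨
        (P.ord (aeval (RatFunc.X : RatFunc K) (X - C c : K[X])) = 1 ∧
          IsLocalRing.residue P.toValuationSubring ⟨RatFunc.X, htO⟩ = algebraMap K _ c) := by
      intro c
      have hc0 : aeval (RatFunc.X : RatFunc K) (X - C c : K[X]) ≠ 0 :=
        aeval_ratFunc_X_ne_zero (X_sub_C_ne_zero c)
      have hnn := P.ord_nonneg_of_mem (P.aeval_mem htO (X - C c))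
      rcases hnn.lt_or_eq with hpos | hzero
      · right
        refine ⟨P.ord_aeval_eq_one_of_separable_of_finrank_eq_one hut hu1 (separable_X_sub_C (x := c))
          hpos, ?_⟩
        have r := (P.ord_aeval_pos_iff htO hc0).1 hpos
        rwa [map_sub, aeval_X, aeval_C, sub_eq_zero] at r
      · left; exact hzero.symm
    rw [map_mul, map_pow, P.ord_mul_eq h10 (pow_ne_zero _ hζ0), P.ord_pow hζ0]
    rcases hv 1 with h1 | ⟨h1, r1⟩ <;> rcases hv ζ with h2 | ⟨h2, r2⟩
    · left; rw [h1, h2]; simp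
    · right; rw [h1, h2, mul_one, zero_add]
      have hq1 : ((q - 1 : ℕ) : ℤ) = q - 1 := by rw [Nat.cast_sub hq]; simp
      rw [hq1]
      exact ⟨-1, 1, by ring⟩
    · right; rw [h1, h2, mul_zero, add_zero]; exact isCoprime_one_left
    · exfalso
      apply hζ1
      have : algebraMap K P.residueField ζ = algebraMap K P.residueField 1 := by
        rw [← r2, r1, map_one]
      exact (algebraMap K P.residueField).injective this
  · left
    have hP : P.ord (RatFunc.X : RatFunc K) < 0 := by
      by_contra hle
      exact htO ((P.mem_toValuationSubring_iff_ord_nonneg hu0).2 (not_lt.1 hle))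
    rw [twoLayer_ord_h₁_of_pole (q - 1) ζ P hP]
    refine ⟨-1, ?_⟩
    have hq1 : ((q - 1 : ℕ) : ℤ) = q - 1 := by rw [Nat.cast_sub hq]; simp
    rw [hq1]; ring

omit [CharZero K] in
/-- **The three cases for `h₁ = (t - 1)(t - ζ)^b` at a place with `t ∈ 𝒪_P`** (`ζ ≠ 1`): either
`t - 1` and `t - ζ` are units (`v_P(h₁) = 0`), or `v_P(t - 1) = 1` and `v_P(h₁) = 1`, or `v_P(t - 1) = 0`,
`v_P(t - ζ) = 1` and `v_P(h₁) = b`. [folklore] -/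
theorem twoLayer_h₁_cases (b : ℕ) {ζ : K} (hζ1 : ζ ≠ 1) (P : PlaceOver K (RatFunc K))
    (htO : (RatFunc.X : RatFunc K) ∈ P.toValuationSubring) :
    (P.ord (aeval (RatFunc.X : RatFunc K) ((X - C 1) * (X - C ζ) ^ b)) = 0 ∧
        P.ord (RatFunc.X - 1 : RatFunc K) = 0) ∨
      (P.ord (aeval (RatFunc.X : RatFunc K) ((X - C 1) * (X - C ζ) ^ b)) = 1 ∧
        P.ord (RatFunc.X - 1 : RatFunc K) = 1) ∨
      (P.ord (aeval (RatFunc.X : RatFunc K) ((X - C 1) * (X - C ζ) ^ b)) = b ∧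
        P.ord (RatFunc.X - 1 : RatFunc K) = 0) := by
  have hut := RatFunc.transcendental_X (K := K)
  have hu1 := finrank_adjoin_ratFunc_X (K := K)
  have h10 : aeval (RatFunc.X : RatFunc K) (X - C 1 : K[X]) ≠ 0 :=
    aeval_ratFunc_X_ne_zero (X_sub_C_ne_zero 1)
  have hζ0 : aeval (RatFunc.X : RatFunc K) (X - C ζ : K[X]) ≠ 0 :=
    aeval_ratFunc_X_ne_zero (X_sub_C_ne_zero ζ)
  have hv : ∀ c : K, P.ord (aeval (RatFunc.X : RatFunc K) (X - C c : K[X])) = 0 ∨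
      (P.ord (aeval (RatFunc.X : RatFunc K) (X - C c : K[X])) = 1 ∧
        IsLocalRing.residue P.toValuationSubring ⟨RatFunc.X, htO⟩ = algebraMap K _ c) := by
    intro c
    have hc0 : aeval (RatFunc.X : RatFunc K) (X - C c : K[X]) ≠ 0 :=
      aeval_ratFunc_X_ne_zero (X_sub_C_ne_zero c)
    have hnn := P.ord_nonneg_of_mem (P.aeval_mem htO (X - C c))
    rcases hnn.lt_or_eq with hpos | hzero
    · right
      refine ⟨P.ord_aeval_eq_one_of_separable_of_finrank_eq_one hut hu1 (separable_X_sub_C (x := c))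
        hpos, ?_⟩
      have r := (P.ord_aeval_pos_iff htO hc0).1 hpos
      rwa [map_sub, aeval_X, aeval_C, sub_eq_zero] at r
    · left; exact hzero.symm
  have haeval1 : aeval (RatFunc.X : RatFunc K) (X - C 1 : K[X]) = RatFunc.X - 1 := by simp
  rw [map_mul, map_pow, P.ord_mul_eq h10 (pow_ne_zero _ hζ0), P.ord_pow hζ0, ← haeval1]
  rcases hv 1 with h1 | ⟨h1, r1⟩ <;> rcases hv ζ with h2 | ⟨h2, r2⟩
  · left; rw [h1, h2]; simp
  · right; right; rw [h1, h2]; simp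
  · right; left; rw [h1, h2]; simp
  · exfalso
    apply hζ1
    have : algebraMap K P.residueField ζ = algebraMap K P.residueField 1 := by
      rw [← r2, r1, map_one]
    exact (algebraMap K P.residueField).injective this

/-- **Off the special fibres `t^n - 1` and `t - 1` are units**: for `π₀` monic irreducible,
`π₀ ∉ {X, X - 1}`, and `v_P(π₀(t^n)) > 0`: `t ∈ 𝒪_P` and `v_P(t^n - 1) = 0`. [folklore] -/
theorem line_mem_and_ord_pow_sub_one_eq_zero {n : ℕ} (hn : 0 < n) {π₀ : K[X]} (hπi : Irreducible π₀)
    (hπm : π₀.Monic) (hπX1 : π₀ ≠ X - 1) (P : PlaceOver K (RatFunc K))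
    (hP : 0 < P.ord (aeval ((RatFunc.X : RatFunc K) ^ n) π₀)) :
    (RatFunc.X : RatFunc K) ∈ P.toValuationSubring ∧ P.ord ((RatFunc.X : RatFunc K) ^ n - 1) = 0 := by
  have hcomp : aeval ((RatFunc.X : RatFunc K) ^ n) π₀ =
      aeval (RatFunc.X : RatFunc K) (π₀.comp (X ^ n)) := by rw [aeval_comp, map_pow, aeval_X]
  rw [hcomp] at hP
  have h1 : π₀.eval 1 ≠ 0 := fun h1 => hπX1 (by
    have h := PlaceOver.eq_X_sub_C_of_irreducible_of_eval_eq_zero hπi hπm h1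
    rwa [map_one] at h)
  have hdeg : 0 < (π₀.comp (X ^ n)).natDegree := by
    rw [natDegree_comp, natDegree_X_pow]
    exact Nat.mul_pos (Irreducible.natDegree_pos hπi) hn
  have hz0 : aeval (RatFunc.X : RatFunc K) (π₀.comp (X ^ n)) ≠ 0 := by
    intro hz; rw [hz, PlaceOver.ord_zero] at hP; exact lt_irrefl _ hP
  have htO : (RatFunc.X : RatFunc K) ∈ P.toValuationSubring := P.mem_of_ord_aeval_pos hdeg hP
  refine ⟨htO, ?_⟩
  have haevalp : aeval (RatFunc.X : RatFunc K) (1 - X ^ n : K[X]) = 1 - RatFunc.X ^ n := by simp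
  have hw0' : aeval (RatFunc.X : RatFunc K) (1 - X ^ n : K[X]) ≠ 0 := by
    refine aeval_ratFunc_X_ne_zero fun h00 => ?_
    have h := congr_arg (eval 0) h00
    simp [hn.ne'] at h
  have hnn : 0 ≤ P.ord (1 - RatFunc.X ^ n : RatFunc K) := by
    rw [← haevalp]; exact P.ord_nonneg_of_mem (P.aeval_mem htO _)
  have hneg : (RatFunc.X ^ n - 1 : RatFunc K) = -(1 - RatFunc.X ^ n) := by ring
  rw [hneg, P.ord_neg]
  by_contra hne
  have hpos : 0 < P.ord (aeval (RatFunc.X : RatFunc K) (1 - X ^ n : K[X])) := by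
    rw [haevalp]; omega
  have r1 := (P.ord_aeval_pos_iff htO hz0).1 hP
  have r2 := (P.ord_aeval_pos_iff htO hw0').1 hpos
  obtain ⟨b₁, b₂, hb⟩ := isCoprime_comp_X_pow_one_sub_X_pow h1 n
  have h := congr_arg (aeval (IsLocalRing.residue P.toValuationSubring ⟨RatFunc.X, htO⟩)) hb
  rw [map_add, map_mul, map_mul, r1, r2, mul_zero, mul_zero, add_zero, map_one] at h
  exact zero_ne_one h

/-- **The fibre `t^n = 1`**: `v_P(t^n - 1) = 1` at each of its zeros, and there `t ∈ 𝒪_P`. [folklore] -/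
theorem line_ord_pow_sub_one_eq_one {n : ℕ} (hn : 0 < n) (P : PlaceOver K (RatFunc K))
    (hP : 0 < P.ord ((RatFunc.X : RatFunc K) ^ n - 1)) :
    P.ord ((RatFunc.X : RatFunc K) ^ n - 1) = 1 ∧ (RatFunc.X : RatFunc K) ∈ P.toValuationSubring := by
  have hut := RatFunc.transcendental_X (K := K)
  have hu1 := finrank_adjoin_ratFunc_X (K := K)
  have hnK : (n : K) ≠ 0 := Nat.cast_ne_zero.2 hn.ne'
  have hsep : (X ^ n - 1 : K[X]).Separable := by
    rw [← C_1]; exact separable_X_pow_sub_C (1 : K) hnK one_ne_zero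
  have haeval : aeval (RatFunc.X : RatFunc K) (X ^ n - 1 : K[X]) = RatFunc.X ^ n - 1 := by simp
  refine ⟨?_, ?_⟩
  · have h := P.ord_aeval_eq_one_of_separable_of_finrank_eq_one hut hu1 hsep (by rwa [haeval])
    rwa [haeval] at h
  · refine P.mem_of_ord_aeval_pos (π := X ^ n - 1) ?_ (by rwa [haeval])
    rw [← C_1, natDegree_X_pow_sub_C]; exact hn

end LineH1

/-! ### C. After the first layer -/

section Layer1

variable {K : Type u} [Field K] [CharZero K]
variable {F₁ : Type u} [Field F₁] [Algebra (RatFunc K) F₁] [Algebra K F₁]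
  [IsScalarTower K (RatFunc K) F₁] [FiniteDimensional (RatFunc K) F₁]
  [Algebra.IsSeparable (RatFunc K) F₁]

omit [CharZero K] [FiniteDimensional (RatFunc K) F₁] [Algebra.IsSeparable (RatFunc K) F₁] in
/-- `h₁ ≠ 0`. [folklore] -/
theorem twoLayer_h₁_ne_zero (b : ℕ) (ζ : K) :
    aeval (RatFunc.X : RatFunc K) ((X - C 1) * (X - C ζ) ^ b) ≠ 0 :=
  aeval_ratFunc_X_ne_zero (mul_ne_zero (X_sub_C_ne_zero 1) (pow_ne_zero _ (X_sub_C_ne_zero ζ)))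

/-- **Layer 1, zeros of `s = t^n`**: `v_Q(s) = n` and `q ∣ v_Q(h₂)` (both layers' functions are units
below `Q`, so `e(Q|P) = 1`). [cite: Stichtenoth2009, Prop. 3.7.3] -/
theorem twoLayer_layer1_zeros {n q : ℕ} (hn : 0 < n) (hq : 0 < q) {ζ : K} (hζn : ζ ^ n = 1)
    (e : ℕ) {g₁ : F₁}
    (hg₁ : g₁ ^ q = algebraMap (RatFunc K) F₁
      (aeval (RatFunc.X : RatFunc K) ((X - C 1) * (X - C ζ) ^ (q - 1))))
    (hgen₁ : IntermediateField.adjoin (RatFunc K) {g₁} = ⊤) (Q : PlaceOver K F₁)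
    (hQ : 0 < Q.ord (algebraMap (RatFunc K) F₁ (RatFunc.X ^ n))) :
    Q.ord (algebraMap (RatFunc K) F₁ (RatFunc.X ^ n)) = n ∧
      (q : ℤ) ∣ Q.ord (algebraMap (RatFunc K) F₁ ((RatFunc.X - 1) ^ e * (RatFunc.X ^ n - 1))) := by
  haveI : IsAlgFunctionField K F₁ := isAlgFunctionField_of_finiteDimensional (K := K) (F := RatFunc K)
  have hqK : (q : K) ≠ 0 := Nat.cast_ne_zero.2 hq.ne'
  have hu0 : (RatFunc.X : RatFunc K) ≠ 0 := RatFunc.X_ne_zero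
  set P := Q.restrict (K := K) (F := RatFunc K) with hP
  have hmul := Q.ord_algebraMap_eq_mul (K := K) (F := RatFunc K) ((RatFunc.X : RatFunc K) ^ n)
  have hmul₂ := Q.ord_algebraMap_eq_mul (K := K) (F := RatFunc K)
    (((RatFunc.X - 1) ^ e * (RatFunc.X ^ n - 1) : RatFunc K))
  have he1 := Q.one_le_ord_algebraMap_uniformizer (K := K) (F := RatFunc K)
  rw [← hP] at hmul hmul₂ he1
  have hPs : 0 < P.ord ((RatFunc.X : RatFunc K) ^ n) := by
    by_contra hle
    have : Q.ord (algebraMap (RatFunc K) F₁ (P.uniformizer : RatFunc K)) *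
        P.ord ((RatFunc.X : RatFunc K) ^ n) ≤ 0 :=
      mul_nonpos_of_nonneg_of_nonpos (by omega) (not_lt.1 hle)
    omega
  obtain ⟨hs, hdvd₂⟩ := powLine_zeros hn e q P hPs
  have hPt : 0 < P.ord (RatFunc.X : RatFunc K) := by
    rw [P.ord_pow hu0] at hPs
    by_contra hle
    have : (n : ℤ) * P.ord (RatFunc.X : RatFunc K) ≤ 0 :=
      mul_nonpos_of_nonneg_of_nonpos (by positivity) (not_lt.1 hle)
    omega
  have hh₁ := twoLayer_ord_h₁_of_zero hn (q - 1) hζn P hPt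
  have he : Q.ord (algebraMap (RatFunc K) F₁ (P.uniformizer : RatFunc K)) = 1 :=
    P.ord_algebraMap_uniformizer_eq_one_of_pow_eq_of_dvd hq hqK (twoLayer_h₁_ne_zero (q - 1) ζ)
      (by rw [hh₁]; exact dvd_zero _) hg₁ hgen₁ Q hP.symm
  refine ⟨by rw [hmul, he, one_mul, hs], ?_⟩
  rw [hmul₂, he, one_mul]
  exact hdvd₂

/-- **Layer 1, poles of `s`**: `v_Q(s) = -n` and `q ∣ v_Q(h₂)` (`v_∞(h₁) = -q`, so `e(Q|∞) = 1`).
[cite: Stichtenoth2009, Prop. 3.7.3] -/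
theorem twoLayer_layer1_poles {n q : ℕ} (hn : 0 < n) (hq : 0 < q) (ζ : K) {e : ℕ}
    (hen : q ∣ e + n) {g₁ : F₁}
    (hg₁ : g₁ ^ q = algebraMap (RatFunc K) F₁
      (aeval (RatFunc.X : RatFunc K) ((X - C 1) * (X - C ζ) ^ (q - 1))))
    (hgen₁ : IntermediateField.adjoin (RatFunc K) {g₁} = ⊤) (Q : PlaceOver K F₁)
    (hQ : Q.ord (algebraMap (RatFunc K) F₁ (RatFunc.X ^ n)) < 0) :
    Q.ord (algebraMap (RatFunc K) F₁ (RatFunc.X ^ n)) = -n ∧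
      (q : ℤ) ∣ Q.ord (algebraMap (RatFunc K) F₁ ((RatFunc.X - 1) ^ e * (RatFunc.X ^ n - 1))) := by
  haveI : IsAlgFunctionField K F₁ := isAlgFunctionField_of_finiteDimensional (K := K) (F := RatFunc K)
  have hqK : (q : K) ≠ 0 := Nat.cast_ne_zero.2 hq.ne'
  have hu0 : (RatFunc.X : RatFunc K) ≠ 0 := RatFunc.X_ne_zero
  set P := Q.restrict (K := K) (F := RatFunc K) with hP
  have hmul := Q.ord_algebraMap_eq_mul (K := K) (F := RatFunc K) ((RatFunc.X : RatFunc K) ^ n)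
  have hmul₂ := Q.ord_algebraMap_eq_mul (K := K) (F := RatFunc K)
    (((RatFunc.X - 1) ^ e * (RatFunc.X ^ n - 1) : RatFunc K))
  have he1 := Q.one_le_ord_algebraMap_uniformizer (K := K) (F := RatFunc K)
  rw [← hP] at hmul hmul₂ he1
  have hPs : P.ord ((RatFunc.X : RatFunc K) ^ n) < 0 := by
    by_contra hle
    have : 0 ≤ Q.ord (algebraMap (RatFunc K) F₁ (P.uniformizer : RatFunc K)) *
        P.ord ((RatFunc.X : RatFunc K) ^ n) :=
      mul_nonneg (by omega) (not_lt.1 hle)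
    omega
  obtain ⟨hs, hdvd₂⟩ := powLine_poles hn hen P hPs
  have hPt : P.ord (RatFunc.X : RatFunc K) < 0 := by
    rw [P.ord_pow hu0] at hPs
    by_contra hle
    have : 0 ≤ (n : ℤ) * P.ord (RatFunc.X : RatFunc K) := mul_nonneg (by positivity) (not_lt.1 hle)
    omega
  have hh₁ := twoLayer_ord_h₁_of_pole (q - 1) ζ P hPt
  have hq1 : ((1 + (q - 1) : ℕ) : ℤ) = q := by
    have : 1 + (q - 1) = q := by omega
    rw [this]
  have he : Q.ord (algebraMap (RatFunc K) F₁ (P.uniformizer : RatFunc K)) = 1 :=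
    P.ord_algebraMap_uniformizer_eq_one_of_pow_eq_of_dvd hq hqK (twoLayer_h₁_ne_zero (q - 1) ζ)
      (by rw [hh₁]; exact ⟨-1, by
        have h1 : ((q - 1 : ℕ) : ℤ) = q - 1 := by rw [Nat.cast_sub hq]; simp
        rw [h1]; ring⟩) hg₁ hgen₁ Q hP.symm
  refine ⟨by rw [hmul, he, one_mul, hs], ?_⟩
  rw [hmul₂, he, one_mul]
  exact hdvd₂

/-- **Layer 1, the fibre `t^n = 1`**: at a place `Q` of `F₁` above a zero `P` of `t^n - 1`, either
`e(Q|P) = q` (above `t = 1` and `t = ζ`), and then `v_Q(t^n - 1) = q` and `q ∣ v_Q(h₂)`; or `e(Q|P) = 1`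
(above the other roots of unity), and then `v_Q(t^n - 1) = 1` and `v_Q(h₂) = v_P(h₂) = 1` is prime to
`q`. [cite: Stichtenoth2009, Prop. 3.7.3] -/
theorem twoLayer_layer1_ones {n q : ℕ} (hn : 0 < n) (hq : 0 < q) {ζ : K} (hζ1 : ζ ≠ 1)
    (e : ℕ) {g₁ : F₁}
    (hg₁ : g₁ ^ q = algebraMap (RatFunc K) F₁
      (aeval (RatFunc.X : RatFunc K) ((X - C 1) * (X - C ζ) ^ (q - 1))))
    (hgen₁ : IntermediateField.adjoin (RatFunc K) {g₁} = ⊤) (Q : PlaceOver K F₁)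
    (hQ : 0 < Q.ord (algebraMap (RatFunc K) F₁ (RatFunc.X ^ n - 1))) :
    (Q.ord (algebraMap (RatFunc K) F₁ (RatFunc.X ^ n - 1)) = q ∧
        (q : ℤ) ∣ Q.ord (algebraMap (RatFunc K) F₁ ((RatFunc.X - 1) ^ e * (RatFunc.X ^ n - 1)))) ∨
      ((q : ℤ) * Q.ord (algebraMap (RatFunc K) F₁ (RatFunc.X ^ n - 1)) = q ∧
        IsCoprime (Q.ord (algebraMap (RatFunc K) F₁ ((RatFunc.X - 1) ^ e * (RatFunc.X ^ n - 1))))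
          (q : ℤ)) := by
  haveI : IsAlgFunctionField K F₁ := isAlgFunctionField_of_finiteDimensional (K := K) (F := RatFunc K)
  have hqK : (q : K) ≠ 0 := Nat.cast_ne_zero.2 hq.ne'
  obtain ⟨h10, hp0, hh₂0⟩ := powLine_h_ne_zero (K := K) hn e
  set P := Q.restrict (K := K) (F := RatFunc K) with hP
  have hmul := Q.ord_algebraMap_eq_mul (K := K) (F := RatFunc K) ((RatFunc.X : RatFunc K) ^ n - 1)
  have hmul₂ := Q.ord_algebraMap_eq_mul (K := K) (F := RatFunc K)
    (((RatFunc.X - 1) ^ e * (RatFunc.X ^ n - 1) : RatFunc K))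
  have he1 := Q.one_le_ord_algebraMap_uniformizer (K := K) (F := RatFunc K)
  rw [← hP] at hmul hmul₂ he1
  have hPs : 0 < P.ord ((RatFunc.X : RatFunc K) ^ n - 1) := by
    by_contra hle
    have : Q.ord (algebraMap (RatFunc K) F₁ (P.uniformizer : RatFunc K)) *
        P.ord ((RatFunc.X : RatFunc K) ^ n - 1) ≤ 0 :=
      mul_nonpos_of_nonneg_of_nonpos (by omega) (not_lt.1 hle)
    omega
  obtain ⟨hone, htO⟩ := line_ord_pow_sub_one_eq_one hn P hPs
  -- `v_P(h₂) = e v_P(t - 1) + 1`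
  have hh₂ : P.ord (((RatFunc.X - 1) ^ e * (RatFunc.X ^ n - 1) : RatFunc K)) =
      e * P.ord (RatFunc.X - 1 : RatFunc K) + 1 := by
    rw [P.ord_mul_eq (pow_ne_zero _ h10) hp0, P.ord_pow h10, hone]
  rcases twoLayer_h₁_cases (q - 1) hζ1 P htO with ⟨hh₁, ht1⟩ | ⟨hh₁, ht1⟩ | ⟨hh₁, ht1⟩
  · -- units: `e(Q|P) = 1`, `v_Q(h₂) = 1`
    right
    have he : Q.ord (algebraMap (RatFunc K) F₁ (P.uniformizer : RatFunc K)) = 1 :=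
      P.ord_algebraMap_uniformizer_eq_one_of_pow_eq_of_dvd hq hqK (twoLayer_h₁_ne_zero (q - 1) ζ)
        (by rw [hh₁]; exact dvd_zero _) hg₁ hgen₁ Q hP.symm
    refine ⟨by rw [hmul, he, one_mul, hone, mul_one], ?_⟩
    rw [hmul₂, he, one_mul, hh₂, ht1, mul_zero, zero_add]
    exact isCoprime_one_left
  · -- above `t = 1`: `v_P(h₁) = 1`, `e(Q|P) = q`
    left
    obtain ⟨he, -⟩ := P.ord_algebraMap_uniformizer_eq_of_pow_eq_of_isCoprime hq
      (twoLayer_h₁_ne_zero (q - 1) ζ) (by rw [hh₁]; exact isCoprime_one_left) hg₁ hgen₁ Q hP.symm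
    refine ⟨by rw [hmul, he, hone, mul_one], ?_⟩
    rw [hmul₂, he]
    exact dvd_mul_right _ _
  · -- above `t = ζ`: `v_P(h₁) = q - 1`, `e(Q|P) = q`
    left
    have hcop : IsCoprime (((q - 1 : ℕ) : ℤ)) (q : ℤ) := by
      have h1 : ((q - 1 : ℕ) : ℤ) = q - 1 := by rw [Nat.cast_sub hq]; simp
      rw [h1]; exact ⟨-1, 1, by ring⟩
    obtain ⟨he, -⟩ := P.ord_algebraMap_uniformizer_eq_of_pow_eq_of_isCoprime hq
      (twoLayer_h₁_ne_zero (q - 1) ζ) (by rw [hh₁]; exact hcop) hg₁ hgen₁ Q hP.symm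
    refine ⟨by rw [hmul, he, hone, mul_one], ?_⟩
    rw [hmul₂, he]
    exact dvd_mul_right _ _

/-- **Layer 1, the other closed points**: for `π₀` monic irreducible, `π₀ ∉ {X, X - 1}`:
`v_Q(π₀(s)) = 1` at its zeros and `q ∣ v_Q(h₂)` (`= 0`). [cite: Stichtenoth2009, Prop. 3.7.3] -/
theorem twoLayer_layer1_elsewhere {n q : ℕ} (hn : 0 < n) (hq : 0 < q) {ζ : K} (hζn : ζ ^ n = 1)
    (e : ℕ) {g₁ : F₁}
    (hg₁ : g₁ ^ q = algebraMap (RatFunc K) F₁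
      (aeval (RatFunc.X : RatFunc K) ((X - C 1) * (X - C ζ) ^ (q - 1))))
    (hgen₁ : IntermediateField.adjoin (RatFunc K) {g₁} = ⊤) {π₀ : K[X]} (hπi : Irreducible π₀)
    (hπm : π₀.Monic) (hπX : π₀ ≠ X) (hπX1 : π₀ ≠ X - 1) (Q : PlaceOver K F₁)
    (hQ : 0 < Q.ord (algebraMap (RatFunc K) F₁ (aeval ((RatFunc.X : RatFunc K) ^ n) π₀))) :
    Q.ord (algebraMap (RatFunc K) F₁ (aeval ((RatFunc.X : RatFunc K) ^ n) π₀)) = 1 ∧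
      (q : ℤ) ∣ Q.ord (algebraMap (RatFunc K) F₁ ((RatFunc.X - 1) ^ e * (RatFunc.X ^ n - 1))) := by
  haveI : IsAlgFunctionField K F₁ := isAlgFunctionField_of_finiteDimensional (K := K) (F := RatFunc K)
  have hqK : (q : K) ≠ 0 := Nat.cast_ne_zero.2 hq.ne'
  set P := Q.restrict (K := K) (F := RatFunc K) with hP
  have hmul := Q.ord_algebraMap_eq_mul (K := K) (F := RatFunc K)
    (aeval ((RatFunc.X : RatFunc K) ^ n) π₀)
  have hmul₂ := Q.ord_algebraMap_eq_mul (K := K) (F := RatFunc K)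
    (((RatFunc.X - 1) ^ e * (RatFunc.X ^ n - 1) : RatFunc K))
  have he1 := Q.one_le_ord_algebraMap_uniformizer (K := K) (F := RatFunc K)
  rw [← hP] at hmul hmul₂ he1
  have hPs : 0 < P.ord (aeval ((RatFunc.X : RatFunc K) ^ n) π₀) := by
    by_contra hle
    have : Q.ord (algebraMap (RatFunc K) F₁ (P.uniformizer : RatFunc K)) *
        P.ord (aeval ((RatFunc.X : RatFunc K) ^ n) π₀) ≤ 0 :=
      mul_nonpos_of_nonneg_of_nonpos (by omega) (not_lt.1 hle)
    omega
  obtain ⟨hone, hdvd₂⟩ := powLine_elsewhere hn e q hπi hπm hπX hπX1 P hPs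
  obtain ⟨htO, hunit⟩ := line_mem_and_ord_pow_sub_one_eq_zero hn hπi hπm hπX1 P hPs
  have hh₁ := twoLayer_ord_h₁_eq_zero hn (q - 1) hζn P htO hunit
  have he : Q.ord (algebraMap (RatFunc K) F₁ (P.uniformizer : RatFunc K)) = 1 :=
    P.ord_algebraMap_uniformizer_eq_one_of_pow_eq_of_dvd hq hqK (twoLayer_h₁_ne_zero (q - 1) ζ)
      (by rw [hh₁]; exact dvd_zero _) hg₁ hgen₁ Q hP.symm
  refine ⟨by rw [hmul, he, one_mul, hone], ?_⟩
  rw [hmul₂, he, one_mul]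
  exact hdvd₂

end Layer1

/-! ### D. The second layer and the covering of signature `(n, q, n)` -/

section Cover

/-- **Two radical layers over the power map: a covering of signature `(n, q, n)`** over (the full
constant field inside `F₂` of) any number field `K` containing a root of unity `ζ ≠ 1`, `ζ^n = 1`:
`F₂ = K(t)(g₁)(g₂)`, `g₁^q = (t - 1)(t - ζ)^{q-1}`, `g₂^q = (t - 1)^e (t^n - 1)` with `q ∣ e + n`, and
`f = t^n`. [cite: Stichtenoth2009, Prop. 3.7.3] [cite: DarmonGranville1995, Prop. 3.1 (p. 525)] -/
theorem exists_belyiMap_signature_two_layer_aux (K : Type u) [Field K] [NumberField K] {n q : ℕ}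
    (hn : 0 < n) (hq : 0 < q) {ζ : K} (hζn : ζ ^ n = 1) (hζ1 : ζ ≠ 1) :
    ∃ (K' : Type u) (_ : Field K') (_ : NumberField K') (F : Type u) (_ : Field F) (_ : Algebra K' F)
      (_ : IsAlgFunctionField K' F) (_ : IsIntegrallyClosedIn K' F) (f : F),
      f ∉ Set.range (algebraMap K' F) ∧
      (∀ P : PlaceOver K' F, 0 < P.ord f → P.ord f = n) ∧
      (∀ P : PlaceOver K' F, 0 < P.ord (f - 1) → P.ord (f - 1) = q) ∧
      (∀ P : PlaceOver K' F, P.ord f < 0 → P.ord f = -n) ∧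
      (∀ π₀ : K'[X], Irreducible π₀ → π₀.Monic → π₀ ≠ X → π₀ ≠ X - 1 →
        ∀ P : PlaceOver K' F, 0 < P.ord (aeval f π₀) → P.ord (aeval f π₀) = 1) := by
  haveI : CharZero (RatFunc K) :=
    charZero_of_injective_algebraMap (algebraMap K (RatFunc K)).injective
  have hqK : (q : K) ≠ 0 := Nat.cast_ne_zero.2 hq.ne'
  -- `e ≡ -n (mod q)`
  set e : ℕ := (q - n % q) % q with he
  have hen : q ∣ e + n := by
    have hm : n % q < q := Nat.mod_lt n hq
    have key : q ∣ e + n % q := by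
      rcases Nat.eq_zero_or_pos (n % q) with h0 | hpos
      · rw [he, h0, Nat.sub_zero, Nat.mod_self]
        exact dvd_zero q
      · rw [he, Nat.mod_eq_of_lt (Nat.sub_lt hq hpos), Nat.sub_add_cancel hm.le]
    have hsplit : e + n = (e + n % q) + q * (n / q) := by
      have h := Nat.mod_add_div n q
      linarith
    rw [hsplit]
    exact (Nat.dvd_add_left (dvd_mul_right q _)).2 key
  obtain ⟨h10, hp0, hh₂0⟩ := powLine_h_ne_zero (K := K) hn e
  -- layer 1
  obtain ⟨F₁, _, _, _, _, _, _, g₁, hg₁, hgen₁⟩ := exists_radical_extension (K := K) (F := RatFunc K)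
    (aeval (RatFunc.X : RatFunc K) ((X - C 1) * (X - C ζ) ^ (q - 1))) hq
  haveI hAF₁ : IsAlgFunctionField K F₁ :=
    isAlgFunctionField_of_finiteDimensional (K := K) (F := RatFunc K)
  haveI : CharZero F₁ := charZero_of_injective_algebraMap (algebraMap K F₁).injective
  -- layer 2
  have hH₂0 : algebraMap (RatFunc K) F₁ ((RatFunc.X - 1) ^ e * (RatFunc.X ^ n - 1)) ≠ 0 :=
    (_root_.map_ne_zero _).2 hh₂0
  obtain ⟨F₂, _, _, _, _, _, _, g₂, hg₂, hgen₂⟩ := exists_radical_extension (K := K) (F := F₁)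
    (algebraMap (RatFunc K) F₁ ((RatFunc.X - 1) ^ e * (RatFunc.X ^ n - 1))) hq
  haveI hAF₂ : IsAlgFunctionField K F₂ := isAlgFunctionField_of_finiteDimensional (K := K) (F := F₁)
  -- the function `f = t^n`
  set S : F₁ := algebraMap (RatFunc K) F₁ (RatFunc.X ^ n) with hS
  set f : F₂ := algebraMap F₁ F₂ S with hf
  have hut := RatFunc.transcendental_X (K := K)
  have hSt : Transcendental K S :=
    (transcendental_algebraMap_iff (algebraMap (RatFunc K) F₁).injective).2 (hut.pow hn)
  have hft : Transcendental K f := (transcendental_algebraMap_iff (algebraMap F₁ F₂).injective).2 hSt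
  -- the four clauses over `K`
  have h₀ : ∀ R : PlaceOver K F₂, 0 < R.ord f → R.ord f = n := fun R hR =>
    PlaceOver.ord_algebraMap_eq_of_forall_ord_pos_of_dvd (K := K) (F := F₁) (F' := F₂) hq hqK hH₂0 hg₂
      hgen₂ (fun Q hQ => twoLayer_layer1_zeros hn hq hζn e hg₁ hgen₁ Q hQ) R hR
  have hi : ∀ R : PlaceOver K F₂, R.ord f < 0 → R.ord f = -n := fun R hR =>
    PlaceOver.ord_algebraMap_eq_of_forall_ord_neg_of_dvd (K := K) (F := F₁) (F' := F₂) hq hqK hH₂0 hg₂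
      hgen₂ (fun Q hQ => twoLayer_layer1_poles hn hq ζ hen hg₁ hgen₁ Q hQ) R hR
  have h₁ : ∀ R : PlaceOver K F₂, 0 < R.ord (f - 1) → R.ord (f - 1) = q := by
    intro R hR
    have heq : f - 1 = algebraMap F₁ F₂ (algebraMap (RatFunc K) F₁ (RatFunc.X ^ n - 1)) := by
      rw [hf, hS, map_sub, map_one, map_sub, map_one]
    rw [heq] at hR ⊢
    exact PlaceOver.ord_algebraMap_eq_of_forall_ord_pos_mixed (K := K) (F := F₁) (F' := F₂) hq hqK
      hH₂0 hg₂ hgen₂ (fun Q hQ => twoLayer_layer1_ones hn hq hζ1 e hg₁ hgen₁ Q hQ) R hR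
  have hunr : ∀ π₀ : K[X], Irreducible π₀ → π₀.Monic → π₀ ≠ X → π₀ ≠ X - 1 →
      ∀ R : PlaceOver K F₂, 0 < R.ord (aeval f π₀) → R.ord (aeval f π₀) = 1 := by
    intro π₀ hπi hπm hX hX1 R hR
    have heq : aeval f π₀ = algebraMap F₁ F₂ (algebraMap (RatFunc K) F₁
        (aeval ((RatFunc.X : RatFunc K) ^ n) π₀)) := by
      rw [hf, hS, aeval_algebraMap_apply, aeval_algebraMap_apply]
    rw [heq] at hR ⊢
    exact PlaceOver.ord_algebraMap_eq_of_forall_ord_pos_of_dvd (K := K) (F := F₁) (F' := F₂) hq hqK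
      hH₂0 hg₂ hgen₂ (fun Q hQ => twoLayer_layer1_elsewhere hn hq hζn e hg₁ hgen₁ hπi hπm hX hX1 Q hQ)
      R hR
  -- pass to the full constant field
  obtain ⟨K', _, _, _, _, _, hfK', h₀', h₁', hi', hunr'⟩ :=
    exists_fullConstantField_of_signature (K := K) (F := F₂) hft h₀ h₁ hi hunr
  exact ⟨K', inferInstance, inferInstance, F₂, inferInstance, inferInstance, inferInstance,
    inferInstance, f, hfK', h₀', h₁', hi', hunr'⟩

/-- **A covering of signature `(n, q, n)` over a number field, for all `n ≥ 2`, `q ≥ 1`**, in the shape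
of the covering input of `finite_properSolutions_of_belyiMap_of_faltings`: the two-layer construction
over the cyclotomic field `ℚ(ζ_n)`. [cite: Stichtenoth2009, Prop. 3.7.3]
[cite: DarmonGranville1995, Prop. 3.1 (p. 525), signature `(n, q, n)`] -/
theorem exists_belyiMap_signature_two_layer {n q : ℕ} (hn : 2 ≤ n) (hq : 0 < q) :
    ∃ (K : Type) (_ : Field K) (_ : NumberField K) (F : Type) (_ : Field F) (_ : Algebra K F)
      (_ : IsAlgFunctionField K F) (_ : IsIntegrallyClosedIn K F) (f : F),
      f ∉ Set.range (algebraMap K F) ∧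
      (∀ P : PlaceOver K F, 0 < P.ord f → P.ord f = n) ∧
      (∀ P : PlaceOver K F, 0 < P.ord (f - 1) → P.ord (f - 1) = q) ∧
      (∀ P : PlaceOver K F, P.ord f < 0 → P.ord f = -n) ∧
      (∀ π₀ : K[X], Irreducible π₀ → π₀.Monic → π₀ ≠ X → π₀ ≠ X - 1 →
        ∀ P : PlaceOver K F, 0 < P.ord (aeval f π₀) → P.ord (aeval f π₀) = 1) := by
  haveI : NeZero n := ⟨by omega⟩
  -- a primitive `n`-th root of unity in `ℚ(ζ_n)` (the instance is passed explicitly to avoid the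
  -- `algebraRat` diamond on `CyclotomicField n ℚ`)
  obtain ⟨ζ, hζ⟩ := @IsCyclotomicExtension.exists_isPrimitiveRoot {n} ℚ (CyclotomicField n ℚ) _ _ _
    (CyclotomicField.isCyclotomicExtension n ℚ) n (Set.mem_singleton n) (NeZero.ne n)
  exact exists_belyiMap_signature_two_layer_aux (CyclotomicField n ℚ) (by omega) hq hζ.pow_eq_one
    (hζ.ne_one hn)

end Cover

end AlgFunctionField

/-! ### E. Darmon–Granville for all signatures with two equal entries, modulo Faltings -/

section DarmonGranville

open AlgFunctionField

/-- **`A x^n + B y^q = C z^n` has finitely many proper solutions for every hyperbolic `(n, q, n)`,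
assuming Faltings' theorem only** (the named fact `finite_ratPlaces_of_two_le_genus`).
[cite: DarmonGranville1995, Theorem 2 (p. 515), signature `(n, q, n)`] -/
theorem finite_properSolutions_signature_nqn_of_faltings {n q : ℕ}
    (hH : q * n + n * n + n * q < n * q * n)
    (hFaltings : ∀ (K' : Type) [Field K'] (F' : Type) [Field F'] [Algebra K' F'],
      finite_ratPlaces_of_two_le_genus K' F')
    {A B C : ℤ} (hA : A ≠ 0) (hB : B ≠ 0) (hC : C ≠ 0) :
    {t : ℤ × ℤ × ℤ | ({t.1, t.2.1, t.2.2} : Finset ℤ).gcd id = 1 ∧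
      A * t.1 ^ n + B * t.2.1 ^ q = C * t.2.2 ^ n}.Finite := by
  obtain ⟨hn0, hq0, -⟩ := hyperbolic_exponents_ne_zero hH
  have hn2 : 2 ≤ n := by
    by_contra hlt
    have hn1 : n = 1 := by omega
    subst hn1
    nlinarith
  obtain ⟨K, _, _, F, _, _, _, _, f, hf, h₀, h₁, hi, hunr⟩ :=
    exists_belyiMap_signature_two_layer hn2 (Nat.pos_of_ne_zero hq0)
  exact finite_properSolutions_of_belyiMap_of_faltings hH hf h₀ h₁ hi hunr hFaltings hA hB hC

/-- **`A x^n + B y^n = C z^q` has finitely many proper solutions for every hyperbolic `(n, n, q)`,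
assuming Faltings' theorem only** — e.g. `(3, 3, 4)`, `(4, 4, 3)`, `(p, p, ℓ)`.
[cite: DarmonGranville1995, Theorem 2 (p. 515), signature `(n, n, q)`] -/
theorem finite_properSolutions_signature_nnq_of_faltings {n q : ℕ}
    (hH : n * q + q * n + n * n < n * n * q)
    (hFaltings : ∀ (K' : Type) [Field K'] (F' : Type) [Field F'] [Algebra K' F'],
      finite_ratPlaces_of_two_le_genus K' F')
    {A B C : ℤ} (hA : A ≠ 0) (hB : B ≠ 0) (hC : C ≠ 0) :
    {t : ℤ × ℤ × ℤ | ({t.1, t.2.1, t.2.2} : Finset ℤ).gcd id = 1 ∧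
      A * t.1 ^ n + B * t.2.1 ^ n = C * t.2.2 ^ q}.Finite := by
  have hH' : q * n + n * n + n * q < n * q * n := by
    have e1 : q * n + n * n + n * q = n * q + q * n + n * n := by ring
    have e2 : n * q * n = n * n * q := by ring
    rw [e1, e2]; exact hH
  exact finite_properSolutions_swap₂₃ (finite_properSolutions_signature_nqn_of_faltings hH'
    hFaltings hA (neg_ne_zero.mpr hC) (neg_ne_zero.mpr hB))

/-- **`A x^q + B y^n = C z^n` has finitely many proper solutions for every hyperbolic `(q, n, n)`,
assuming Faltings' theorem only** — e.g. `(2, ℓ, ℓ)` for `ℓ ≥ 5`, `(2, 5, 5)`, `(2, 6, 6)`, `(3, 4, 4)`.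
[cite: DarmonGranville1995, Theorem 2 (p. 515), signature `(q, n, n)`] -/
theorem finite_properSolutions_signature_qnn_of_faltings {n q : ℕ}
    (hH : n * n + n * q + q * n < q * n * n)
    (hFaltings : ∀ (K' : Type) [Field K'] (F' : Type) [Field F'] [Algebra K' F'],
      finite_ratPlaces_of_two_le_genus K' F')
    {A B C : ℤ} (hA : A ≠ 0) (hB : B ≠ 0) (hC : C ≠ 0) :
    {t : ℤ × ℤ × ℤ | ({t.1, t.2.1, t.2.2} : Finset ℤ).gcd id = 1 ∧
      A * t.1 ^ q + B * t.2.1 ^ n = C * t.2.2 ^ n}.Finite := by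
  have hH' : q * n + n * n + n * q < n * q * n := by
    have e1 : q * n + n * n + n * q = n * n + n * q + q * n := by ring
    have e2 : n * q * n = q * n * n := by ring
    rw [e1, e2]; exact hH
  exact finite_properSolutions_swap₁₂ (finite_properSolutions_signature_nqn_of_faltings hH'
    hFaltings hB hA hC)

end DarmonGranville

end Literature.NumberTheory.DiophantineGeometry
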